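import Summits.QuantumFields.YangMills.Theorems.LuscherReductionTwistedTraceScalingBTFibreProfile
import Summits.QuantumFields.YangMills.Theorems.LuscherReductionTwistedTraceScalingFibreMassBrick
import HarnessLib

/-!
# THE DUAL PROFILE IDENTITY on the tube: `Ω·w = e^{−q}·𝟙_{‖x‖≤r}·N` and `Ω²·w = e^{−‖P_Γx‖²/δg²}·e^{−2q}·𝟙·N` for the frozen profile and a weight of record shape
# (lane A of S-BASE, crux `TwistedTraceScaling` stmt-QuantumFields-20203, C4-CORE, the (OD) pen; COARSE-DESIGN §27.3 / §27.7 (C4), `pub/ym-fleet/ym-luscher-20007-p1/`)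

The `L²(w)` door (`…BODefect`) compares `K̃(φ⊗Ω)` with `(ψ⊗Ω)·w`, `w = softWeight χ = N/χ`.  For the frozen profile `Ω = frozenProfile L q r β` (gauge Gaussian of width `powScale 1 β`) and a
weight of record shape `χ = 𝟙_F·e^{−gaugeCoordSq/(powScale 1 β)²}` (e.g. `recordChi L s K M β`), the gauge Gaussians CANCEL EXACTLY on the tube (`gaugeCoordSq_orthoTube`):
* ★★ `frozenProfile_mul_softWeight_orthoTube` — at `U = orthoTube u v`, `v` in the cap, `U ∈ F`:  `Ω(v̂)·w(U) = e^{−q β v̂}·𝟙{‖v̂‖ ≤ r β}·N(U)`, `N = gaugeAvg χ`;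
* ★★ `frozenProfile_sq_mul_softWeight_orthoTube` — `Ω(v̂)²·w(U) = e^{−‖P_Γ v̂‖²/(powScale 1 β)²}·e^{−2 q β v̂}·𝟙{‖v̂‖ ≤ r β}·N(U)` (the integrand of `fibreMass`);
* `softWeight_eq_div`, `inv_softWeight_eq` — `w = N/χ` and `1/w = χ/N` where `χ ≠ 0`; with (P) (`N ≥ N̄(1−κ)` on `F`) `1/w ≤ 1/(N̄(1−κ))` (`inv_softWeight_le`).
So the dual BO function of the door is `(ψ⊗e^{−q}𝟙)·N` — NO narrow Gaussian in the fibre variable — and the `1/w` weight of the defect integral is `≤ χ/(N̄(1−κ)) ≤ 1/(N̄(1−κ))`,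
and `≤ e^{−‖P_Γx'‖²β²}/(N̄(1−κ))` in the gauge-far region (§27.3 (c)).
HONEST FRAMING: exact algebra for a stub of a child of the CONDITIONAL route R2b1; (C1c), (C1d), tails, (B-ST) OPEN; C4-CORE OPEN; not infinite volume, not a gap, not Clay.
-/

set_option autoImplicit false

noncomputable section

open MeasureTheory Filter Topology Real
open scoped BigOperators
open Literature.MathematicalPhysics.QuantumFieldTheory
open Literature.MathematicalPhysics.QuantumLattice

namespace Summit.QuantumFields.YangMills.Theorems.FemtoTransferGap.TwoLattice.ConstTube

open Summit.QuantumFields.YangMills.Theorems.FemtoTransferGap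
open Summit.QuantumFields.YangMills.Theorems.FemtoTransferGap.TwoLattice
open Summit.QuantumFields.YangMills.Theorems.FemtoTransferGap.TwoLattice.Avg
open Summit.QuantumFields.YangMills.Theorems.FemtoTransferGap.TwoLattice.Stiff (LinkSpace)

variable {L : ℕ} [NeZero L]

/-! ## §1 The soft weight as a quotient -/

/-- `softWeight χ U = gaugeAvg χ U / χ U`. [folklore] -/
theorem softWeight_eq_div (χ : GaugeConfig 3 L SU2 → ℝ) (U : GaugeConfig 3 L SU2) : softWeight χ U = gaugeAvg χ U / χ U := rfl

/-- `1/w = χ/N` (as real numbers, with the usual conventions for `0`). [folklore] -/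
theorem inv_softWeight_eq (χ : GaugeConfig 3 L SU2 → ℝ) (U : GaugeConfig 3 L SU2) : (softWeight χ U)⁻¹ = χ U / gaugeAvg χ U := by
  rw [softWeight_eq_div, inv_div]

/-- With `χ ≤ 1` and `N ≥ N̄(1−κ) > 0` at `U`: `1/w ≤ 1/(N̄(1−κ))`. [folklore] -/
theorem inv_softWeight_le {χ : GaugeConfig 3 L SU2 → ℝ} {U : GaugeConfig 3 L SU2} (hχ1 : χ U ≤ 1) {Nbar κ : ℝ} (hNκ : 0 < Nbar * (1 - κ))
    (hN : Nbar * (1 - κ) ≤ gaugeAvg χ U) : (softWeight χ U)⁻¹ ≤ 1 / (Nbar * (1 - κ)) := by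
  have hNpos : 0 < gaugeAvg χ U := hNκ.trans_le hN
  rw [inv_softWeight_eq χ U]
  calc χ U / gaugeAvg χ U ≤ 1 / gaugeAvg χ U := div_le_div_of_nonneg_right hχ1 hNpos.le
    _ ≤ 1 / (Nbar * (1 - κ)) := one_div_le_one_div_of_le hNκ hN

/-! ## §2 ★★ The dual profile identities on the tube -/

/-- ★★ **DUAL PROFILE IDENTITY.**  For a weight of record shape `χ = 𝟙_F·e^{−gaugeCoordSq/(powScale 1 β)²}` and the frozen profile with the same gauge width, at a tube point
`U = orthoTube u v` (`v` in the cap) lying in `F`:  `Ω(v̂)·w(U) = e^{−q β v̂}·𝟙{‖v̂‖ ≤ r β}·N(U)`. [cite: Luscher1983, §3] -/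
theorem frozenProfile_mul_softWeight_orthoTube {F : Set (GaugeConfig 3 L SU2)} {χ : GaugeConfig 3 L SU2 → ℝ} {β : ℝ}
    (hχ : ∀ U, χ U = F.indicator (fun _ => (1 : ℝ)) U * Real.exp (-(gaugeCoordSq L U / powScale 1 β ^ 2)))
    (q : ℝ → LinkSpace L → ℝ) (r : ℝ → ℝ) (u : GaugeConfig 3 1 SU2) {v : Edge 3 L → Fin 3 → ℝ} (hv : v ∈ capBalancedSet L) (hU : orthoTube L u v ∈ F) :
    frozenProfile L q r β (linkEmbed L v) * softWeight χ (orthoTube L u v) =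
      Real.exp (-(q β (linkEmbed L v))) * (Metric.closedBall (0 : LinkSpace L) (r β)).indicator (fun _ => (1 : ℝ)) (linkEmbed L v) * gaugeAvg χ (orthoTube L u v) := by
  have hχU : χ (orthoTube L u v) = Real.exp (-(‖(gaugeModes L).starProjection (linkEmbed L v)‖ ^ 2 / powScale 1 β ^ 2)) := by
    rw [hχ, Set.indicator_of_mem hU, one_mul, gaugeCoordSq_orthoTube u hv]
  have hg : Real.exp (-(‖(gaugeModes L).starProjection (linkEmbed L v)‖ ^ 2 / powScale 1 β ^ 2)) ≠ 0 := (Real.exp_pos _).ne'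
  rw [softWeight_eq_div, hχU]
  unfold frozenProfile
  field_simp

/-- ★★ **The fibre-mass integrand**: `Ω(v̂)²·w(U) = e^{−‖P_Γ v̂‖²/(powScale 1 β)²}·e^{−2q β v̂}·𝟙{‖v̂‖ ≤ r β}·N(U)` at tube points of `F`. [cite: Luscher1983, §3] -/
theorem frozenProfile_sq_mul_softWeight_orthoTube {F : Set (GaugeConfig 3 L SU2)} {χ : GaugeConfig 3 L SU2 → ℝ} {β : ℝ}
    (hχ : ∀ U, χ U = F.indicator (fun _ => (1 : ℝ)) U * Real.exp (-(gaugeCoordSq L U / powScale 1 β ^ 2)))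
    (q : ℝ → LinkSpace L → ℝ) (r : ℝ → ℝ) (u : GaugeConfig 3 1 SU2) {v : Edge 3 L → Fin 3 → ℝ} (hv : v ∈ capBalancedSet L) (hU : orthoTube L u v ∈ F) :
    frozenProfile L q r β (linkEmbed L v) ^ 2 * softWeight χ (orthoTube L u v) =
      Real.exp (-(‖(gaugeModes L).starProjection (linkEmbed L v)‖ ^ 2 / powScale 1 β ^ 2)) * Real.exp (-(2 * q β (linkEmbed L v))) *
        (Metric.closedBall (0 : LinkSpace L) (r β)).indicator (fun _ => (1 : ℝ)) (linkEmbed L v) * gaugeAvg χ (orthoTube L u v) := by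
  have h1 := frozenProfile_mul_softWeight_orthoTube hχ q r u hv hU
  have hind : (Metric.closedBall (0 : LinkSpace L) (r β)).indicator (fun _ => (1 : ℝ)) (linkEmbed L v) ^ 2 =
      (Metric.closedBall (0 : LinkSpace L) (r β)).indicator (fun _ => (1 : ℝ)) (linkEmbed L v) := by
    by_cases hx : linkEmbed L v ∈ Metric.closedBall (0 : LinkSpace L) (r β)
    · rw [Set.indicator_of_mem hx]; norm_num
    · rw [Set.indicator_of_notMem hx]; norm_num
  have e2 : Real.exp (-(2 * q β (linkEmbed L v))) = Real.exp (-(q β (linkEmbed L v))) * Real.exp (-(q β (linkEmbed L v))) := by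
    rw [← Real.exp_add]; congr 1; ring
  calc frozenProfile L q r β (linkEmbed L v) ^ 2 * softWeight χ (orthoTube L u v)
      = frozenProfile L q r β (linkEmbed L v) * (frozenProfile L q r β (linkEmbed L v) * softWeight χ (orthoTube L u v)) := by ring
    _ = frozenProfile L q r β (linkEmbed L v) * (Real.exp (-(q β (linkEmbed L v))) *
          (Metric.closedBall (0 : LinkSpace L) (r β)).indicator (fun _ => (1 : ℝ)) (linkEmbed L v) * gaugeAvg χ (orthoTube L u v)) := by rw [h1]
    _ = _ := by
        unfold frozenProfile
        rw [e2]
        have hi := hind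
        calc Real.exp (-(‖(gaugeModes L).starProjection (linkEmbed L v)‖ ^ 2 / powScale 1 β ^ 2)) * Real.exp (-(q β (linkEmbed L v))) *
              (Metric.closedBall (0 : LinkSpace L) (r β)).indicator (fun _ => (1 : ℝ)) (linkEmbed L v) *
              (Real.exp (-(q β (linkEmbed L v))) * (Metric.closedBall (0 : LinkSpace L) (r β)).indicator (fun _ => (1 : ℝ)) (linkEmbed L v) * gaugeAvg χ (orthoTube L u v))
            = Real.exp (-(‖(gaugeModes L).starProjection (linkEmbed L v)‖ ^ 2 / powScale 1 β ^ 2)) * (Real.exp (-(q β (linkEmbed L v))) * Real.exp (-(q β (linkEmbed L v)))) *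
                ((Metric.closedBall (0 : LinkSpace L) (r β)).indicator (fun _ => (1 : ℝ)) (linkEmbed L v) ^ 2) * gaugeAvg χ (orthoTube L u v) := by ring
          _ = _ := by rw [hi]

/-- The record weight has record shape with `F` = its fat tube and gauge width `powScale 1 β`. [folklore] -/
theorem recordChi_eq_indicator_mul (s K M β : ℝ) (U : GaugeConfig 3 L SU2) :
    recordChi L s K M β U = (fatTubeRho L (fun β => K * powScale s β) (fun b => M * (K * powScale s b)) β).indicator (fun _ => (1 : ℝ)) U *
      Real.exp (-(gaugeCoordSq L U / powScale 1 β ^ 2)) := rfl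

/-- ★★ **The record instance**: for `Ω = frozenProfile L q r β` and `w = softWeight (recordChi L s K M β)`, at tube points of the record fat tube,
`Ω(v̂)·w(U) = e^{−q β v̂}·𝟙{‖v̂‖ ≤ r β}·N(U)`. [cite: Luscher1983, §3] -/
theorem frozenProfile_mul_softWeight_recordChi (s K M β : ℝ) (q : ℝ → LinkSpace L → ℝ) (r : ℝ → ℝ) (u : GaugeConfig 3 1 SU2) {v : Edge 3 L → Fin 3 → ℝ}
    (hv : v ∈ capBalancedSet L) (hU : orthoTube L u v ∈ fatTubeRho L (fun β => K * powScale s β) (fun b => M * (K * powScale s b)) β) :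
    frozenProfile L q r β (linkEmbed L v) * softWeight (recordChi L s K M β) (orthoTube L u v) =
      Real.exp (-(q β (linkEmbed L v))) * (Metric.closedBall (0 : LinkSpace L) (r β)).indicator (fun _ => (1 : ℝ)) (linkEmbed L v) *
        gaugeAvg (recordChi L s K M β) (orthoTube L u v) :=
  frozenProfile_mul_softWeight_orthoTube (recordChi_eq_indicator_mul (L := L) s K M β) q r u hv hU

end Summit.QuantumFields.YangMills.Theorems.FemtoTransferGap.TwoLattice.ConstTube

end
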